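import Summits.Parity.GeneralizedHardyLittlewood.Theorems.BeyondDiagonalBeatsQuarter.OffDiagDualLedgerTotal
import Summits.Parity.GeneralizedHardyLittlewood.Theorems.BeyondDiagonalBeatsQuarter.OffDiagDualLedgerScales
import Literature.NumberTheory.Sieve.DivisorBound
import HarnessLib

/-!
# Route `PrimeLevelFamEdge`, crux K_B (stmt-Parity-20343), line `diagonal_kernel_split` rev 4, plan Ω,
# worker key L3 (part 6e) `OffDiagDualLedgerMainScale`: the trivial ledger IN THE CURRENCY OF THE HEART —
# at the clean scales the doubly truncated dual core is `≤ q^{(5/4)(Δ′−1) + 2ε₀ + ε}·mainScaleReal Δ′ q`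

`OffDiagDualLedgerTotal.dualLedgerTotal_le` bounds the trivial ledger of the finite dual core (every term in
absolute value) for arbitrary parameters `M, R, y₀, Λ, Q, δ, C`; `OffDiagDualLedgerScales` evaluates the row
constant at the scales of the heart. This file assembles:
* `ledger_length_factor_le` (`C²M^{2δ+1}·CM^{δ+1} ≤ C³q^{3δ}q̂^{2Δ′}` at `M = q̂^{Δ′}`) and
  **`ledger_rhs_scales_le`** — the right-hand side of the ledger at these scales, times the prefactor
  `‖2q̂(2π/q)‖ = 4πq̂/q`, is `≤ K(C,Λ₀)·(log q)^{10}·q^{30δ + 2ε₀ + (5/4)(Δ′−1)}·mainScaleReal Δ′ q`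
  (`K = 19514880·C⁴(Λ₀+1)²(4(Λ₀+1)²+1)`);
* **`dualLedgerTotal_scales_le`** — for `Λ₀ ≥ 0`, `0 ≤ ε₀ ≤ 1`, `ε > 0` there is `q₀` such that for all primes
  `q ≥ q₀`, all `Δ′ ∈ (1,2]` and all truncations `A` with `A_j ≤ Λ₀·q(r+1)(1+Z)q^{ε₀}/2^{i_j} + 1`
  (coordinatewise — the shape L2's truncation lemma produces; `τ(n) ≤ C_δn^δ` from `DivisorBound`,
  `δ = min(1, ε/60)`, logarithms absorbed by `exists_mul_log_pow_le_rpow`):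
  `(4πq̂/q)·Σ_{r<q⁷}Σ_{l,m≤q̂^{Δ′}}|c_lc_m|Σ_{d₁∣l,d₂∣m}Σ_{i near}Σ_{|h_j|≤A_j}‖Φ̂_i(h/(q(r+1)))‖·N ≤ q^{(5/4)(Δ′−1)+2ε₀+ε}·ms`;
* §4: the heights `H_j = ⌈q(r+1)·D_j·q^{ε₀}/(2π)⌉` of L2's truncation lemma
  (`OffDiagDualTruncationBox.tsum_tail_norm_fourier2_boxWeight_le`, `D_j = 2(1+2Z)/K_j`) are coordinatewise
  admissible with `Λ₀ = 2/π` (`truncHeight_fst_le`, `truncHeight_snd_le`, `natCeil_le_add_one`).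
READING: the trivial exponent is `κ₀ = 5/4` (in `η = Δ′−1`): `q̂^{2Δ′}` from the mollifier lengths, `q̂^{η/2}` from
the dual density `(1+Z)^{1/2}`, against `ms ≍ q̂`; `q = 4π²q̂²`. What the heart must SAVE over this ledger is
`q^{(5/4)η + o(1)}` — by cancellation (L4–L6), not by size. For the lead's `offDiagCore Hf` (second frequency
complete) one first removes the `h₂`-tail by L2 (`boxWeight_swap`), a (T)-type estimate, then applies this file
with `A = (Hf, H₂f)`. Elementary bookkeeping; nothing about the heart. Helper (`--supports stmt-Parity-20343`);
standard axioms.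
«The programme SEARCHES and TYPES; no claim about Landau–Siegel zeros, Theorems 1–2 of arXiv:2211.02515 or
a repaired Margin232 until a kernel theorem says so.»
-/

noncomputable section

open Finset Polynomial
open scoped Real

namespace Summit.Parity.GeneralizedHardyLittlewood.Theorems.BeyondDiagonalBeatsQuarter.OffDiag

open Literature.NumberTheory.LFunctions Literature.NumberTheory.LFunctions.KMV2000
open Literature.NumberTheory.Sieve.FriedlanderIwaniecPrimes (fourier2)
open PeterssonSplit (two_pi_mul_qhat_sq qhat_sq_le)

variable {q : ℕ}

/-! ### §2 (continued). The mollifier lengths and the assembled right-hand side -/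

/-- F6 — the mollifier-length factor at `M = q̂^{Δ′}`: `C²M^{2δ+1}·CM^{δ+1} ≤ C³·q^{3δ}·q̂^{2Δ′}`
(`q̂^{3δΔ′} ≤ q̂^{6δ} ≤ q^{3δ}`). [cite: KowalskiMichelVanderKam2000, (21)–(23) p. 12 — derivation] -/
theorem ledger_length_factor_le (hq : 40 ≤ q) {Δ' : ℝ} (h2 : Δ' ≤ 2) {C δ : ℝ} (hC : 0 ≤ C)
    (hδ0 : 0 ≤ δ) :
    (C ^ 2 * (qhat q ^ Δ') ^ (2 * δ + 1)) * (C * (qhat q ^ Δ') ^ (δ + 1)) ≤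
      C ^ 3 * (q : ℝ) ^ (3 * δ) * qhat q ^ (2 * Δ') := by
  set s : ℝ := qhat q with hs
  have hs1 : 1 < s := one_lt_qhat hq
  have hs0 : 0 < s := lt_trans one_pos hs1
  have hsq : s ^ 2 ≤ (q : ℝ) := qhat_sq_le q
  have hM0 : 0 < s ^ Δ' := Real.rpow_pos_of_pos hs0 _
  have hcomb : (s ^ Δ') ^ (2 * δ + 1) * (s ^ Δ') ^ (δ + 1) = s ^ (3 * δ * Δ') * s ^ (2 * Δ') := by
    rw [← Real.rpow_add hM0, ← Real.rpow_mul hs0.le, ← Real.rpow_add hs0]; ring_nf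
  have h3δ : s ^ (3 * δ * Δ') ≤ (q : ℝ) ^ (3 * δ) := by
    calc s ^ (3 * δ * Δ') ≤ s ^ (6 * δ) :=
          Real.rpow_le_rpow_of_exponent_le hs1.le (by nlinarith)
      _ = (s ^ 2) ^ (3 * δ) := by
          rw [← Real.rpow_natCast s 2, ← Real.rpow_mul hs0.le]; ring_nf
      _ ≤ (q : ℝ) ^ (3 * δ) := Real.rpow_le_rpow (by positivity) hsq (by positivity)
  calc (C ^ 2 * (s ^ Δ') ^ (2 * δ + 1)) * (C * (s ^ Δ') ^ (δ + 1))
      = C ^ 3 * ((s ^ Δ') ^ (2 * δ + 1) * (s ^ Δ') ^ (δ + 1)) := by ring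
    _ = C ^ 3 * (s ^ (3 * δ * Δ') * s ^ (2 * Δ')) := by rw [hcomb]
    _ ≤ C ^ 3 * ((q : ℝ) ^ (3 * δ) * s ^ (2 * Δ')) := by gcongr
    _ = C ^ 3 * (q : ℝ) ^ (3 * δ) * s ^ (2 * Δ') := by ring

/-- **The ledger's right-hand side at the clean scales, in the currency of the heart.** For `q ≥ 40`,
`1 < Δ′ ≤ 2`, `C ≥ 1`, `0 ≤ δ ≤ 1`, `Λ₀ ≥ 0`, `0 ≤ ε₀ ≤ 1`:
`(4πq̂/q)·(log₂⌊4q̂²log⁴q⌋+1)²·ledgerRow(q, q̂^{Δ′}, q⁷, log⁴q, (Λ₀+1)²log⁴q, q^{ε₀}, δ, C)·(1+log q⁷)·C³(q̂^{Δ′})^{3δ+2}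
  ≤ K·(log q)^{10}·q^{30δ+2ε₀+(5/4)(Δ′−1)}·mainScaleReal Δ′ q`, `K = 19514880·C⁴(Λ₀+1)²(4(Λ₀+1)²+1)`.
[cite: KowalskiMichelVanderKam2000, (21)–(23) p. 12, §6 p. 19 — derivation] -/
theorem ledger_rhs_scales_le (hq : 40 ≤ q) {Δ' : ℝ} (h1 : 1 < Δ') (h2 : Δ' ≤ 2) {C δ Λ₀ ε₀ : ℝ}
    (hC : 0 ≤ C) (hδ0 : 0 ≤ δ) (hδ1 : δ ≤ 1) (hΛ₀ : 0 ≤ Λ₀) (hε₀ : 0 ≤ ε₀) (hε₁ : ε₀ ≤ 1) :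
    4 * π * qhat q / q *
      ((((Nat.log 2 ⌊4 * qhat q ^ 2 * Real.log q ^ 4⌋₊ + 1) ^ 2 : ℕ) : ℝ) *
        ledgerRow q (qhat q ^ Δ') ((q ^ 7 : ℕ) : ℝ) (Real.log q ^ 4) ((Λ₀ + 1) ^ 2 * Real.log q ^ 4)
          ((q : ℝ) ^ ε₀) δ C *
        (1 + Real.log ((q ^ 7 : ℕ) : ℝ)) *
        ((C ^ 2 * (qhat q ^ Δ') ^ (2 * δ + 1)) * (C * (qhat q ^ Δ') ^ (δ + 1)))) ≤
    19514880 * C ^ 4 * (Λ₀ + 1) ^ 2 * (4 * (Λ₀ + 1) ^ 2 + 1) * Real.log q ^ 10 *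
      (q : ℝ) ^ (30 * δ + 2 * ε₀ + 5 / 4 * (Δ' - 1)) * mainScaleReal Δ' q := by
  set s : ℝ := qhat q with hs
  set L : ℝ := Real.log q with hL
  have hs1 : 1 < s := one_lt_qhat hq
  have hs0 : 0 < s := lt_trans one_pos hs1
  have hq0 : (0 : ℝ) < q := by exact_mod_cast (show 0 < q by omega)
  have hL1 : 1 ≤ L := one_le_log hq
  have hL0 : 0 < L := lt_of_lt_of_le one_pos hL1
  have hsq : s ^ 2 ≤ (q : ℝ) := qhat_sq_le q
  have hq_eq : (q : ℝ) = 4 * π ^ 2 * s ^ 2 := by rw [hs, ← two_pi_mul_qhat_sq q]; ring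
  -- the four factors
  have hF1 : ((((Nat.log 2 ⌊4 * s ^ 2 * L ^ 4⌋₊ + 1) ^ 2 : ℕ)) : ℝ) ≤ 121 * L ^ 2 := natLog_floor_sq_le hq
  have hrow := ledgerRow_scales_le hq h1.le h2 hC hδ0 hδ1 hΛ₀ hε₀ hε₁
  have hrow0 : 0 ≤ ledgerRow q (s ^ Δ') ((q ^ 7 : ℕ) : ℝ) (L ^ 4) ((Λ₀ + 1) ^ 2 * L ^ 4) ((q : ℝ) ^ ε₀) δ C :=
    ledgerRow_nonneg q hC (by positivity) (by positivity)
  have hF5 : 1 + Real.log ((q ^ 7 : ℕ) : ℝ) ≤ 8 * L := by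
    rw [Nat.cast_pow, Real.log_pow]; push_cast; linarith
  have hF50 : 0 ≤ 1 + Real.log ((q ^ 7 : ℕ) : ℝ) := by
    rw [Nat.cast_pow, Real.log_pow]; positivity
  have hF6 := ledger_length_factor_le hq h2 hC hδ0 (Δ' := Δ')
  have hF60 : 0 ≤ (C ^ 2 * (s ^ Δ') ^ (2 * δ + 1)) * (C * (s ^ Δ') ^ (δ + 1)) := by positivity
  rw [← hs, ← hL] at hrow
  rw [← hs] at hF6
  have hprod : ((((Nat.log 2 ⌊4 * s ^ 2 * L ^ 4⌋₊ + 1) ^ 2 : ℕ)) : ℝ) *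
      ledgerRow q (s ^ Δ') ((q ^ 7 : ℕ) : ℝ) (L ^ 4) ((Λ₀ + 1) ^ 2 * L ^ 4) ((q : ℝ) ^ ε₀) δ C *
      (1 + Real.log ((q ^ 7 : ℕ) : ℝ)) *
      ((C ^ 2 * (s ^ Δ') ^ (2 * δ + 1)) * (C * (s ^ Δ') ^ (δ + 1))) ≤
      (121 * L ^ 2) * (2520 * π * (2 * C * (4 * (Λ₀ + 1) ^ 2 * (q : ℝ) ^ (27 * δ))) *
        ((4 * (Λ₀ + 1) ^ 2 + 1) * L ^ 5 * ((q : ℝ) ^ ε₀) ^ 2 * s ^ ((Δ' - 1) / 2))) * (8 * L) *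
        (C ^ 3 * (q : ℝ) ^ (3 * δ) * s ^ (2 * Δ')) :=
    mul_le_mul (mul_le_mul (mul_le_mul hF1 hrow hrow0 (by positivity)) hF5 hF50 (by positivity))
      hF6 hF60 (by positivity)
  -- prefactor and regrouping
  have hpre : 4 * π * s / q = (π * s)⁻¹ := by
    rw [hq_eq]; field_simp
  have hpre0 : 0 ≤ 4 * π * s / q := by positivity
  have hspow : (π * s)⁻¹ * (s ^ ((Δ' - 1) / 2) * s ^ (2 * Δ')) = π⁻¹ * (s * s ^ (5 / 4 * (Δ' - 1) * 2)) := by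
    have h' : s ^ ((Δ' - 1) / 2) * s ^ (2 * Δ') = s * (s * s ^ (5 / 4 * (Δ' - 1) * 2)) := by
      rw [← Real.rpow_add hs0, show (Δ' - 1) / 2 + 2 * Δ' = 1 + (1 + 5 / 4 * (Δ' - 1) * 2) by ring,
        Real.rpow_add hs0, Real.rpow_one, Real.rpow_add hs0, Real.rpow_one]
    rw [h', mul_inv]
    field_simp
  have hs52 : s ^ (5 / 4 * (Δ' - 1) * 2) ≤ (q : ℝ) ^ (5 / 4 * (Δ' - 1)) := by
    rw [show (5 / 4 * (Δ' - 1) * 2 : ℝ) = ((2 : ℕ) : ℝ) * (5 / 4 * (Δ' - 1)) by push_cast; ring,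
      Real.rpow_mul hs0.le, Real.rpow_natCast]
    exact Real.rpow_le_rpow (by positivity) hsq (by nlinarith)
  have hs_ms : s ≤ L ^ 2 * mainScaleReal Δ' q := qhat_le_log_sq_mul_mainScaleReal hq h1 h2
  have hms0 : 0 ≤ mainScaleReal Δ' q := mainScaleReal_nonneg _ _
  have hQsq : ((q : ℝ) ^ ε₀) ^ 2 = (q : ℝ) ^ (2 * ε₀) := by
    rw [← Real.rpow_natCast, ← Real.rpow_mul hq0.le]; ring_nf
  have hqpow : (q : ℝ) ^ (27 * δ) * (q : ℝ) ^ (3 * δ) * ((q : ℝ) ^ ε₀) ^ 2 * (q : ℝ) ^ (5 / 4 * (Δ' - 1)) =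
      (q : ℝ) ^ (30 * δ + 2 * ε₀ + 5 / 4 * (Δ' - 1)) := by
    rw [hQsq, ← Real.rpow_add hq0, ← Real.rpow_add hq0, ← Real.rpow_add hq0]; ring_nf
  calc 4 * π * s / q * (((((Nat.log 2 ⌊4 * s ^ 2 * L ^ 4⌋₊ + 1) ^ 2 : ℕ)) : ℝ) *
        ledgerRow q (s ^ Δ') ((q ^ 7 : ℕ) : ℝ) (L ^ 4) ((Λ₀ + 1) ^ 2 * L ^ 4) ((q : ℝ) ^ ε₀) δ C *
        (1 + Real.log ((q ^ 7 : ℕ) : ℝ)) *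
        ((C ^ 2 * (s ^ Δ') ^ (2 * δ + 1)) * (C * (s ^ Δ') ^ (δ + 1))))
      ≤ 4 * π * s / q * ((121 * L ^ 2) * (2520 * π * (2 * C * (4 * (Λ₀ + 1) ^ 2 * (q : ℝ) ^ (27 * δ))) *
        ((4 * (Λ₀ + 1) ^ 2 + 1) * L ^ 5 * ((q : ℝ) ^ ε₀) ^ 2 * s ^ ((Δ' - 1) / 2))) * (8 * L) *
        (C ^ 3 * (q : ℝ) ^ (3 * δ) * s ^ (2 * Δ'))) := mul_le_mul_of_nonneg_left hprod hpre0
    _ = 19514880 * C ^ 4 * (Λ₀ + 1) ^ 2 * (4 * (Λ₀ + 1) ^ 2 + 1) * L ^ 8 *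
        ((q : ℝ) ^ (27 * δ) * (q : ℝ) ^ (3 * δ) * ((q : ℝ) ^ ε₀) ^ 2) *
        (π * ((π * s)⁻¹ * (s ^ ((Δ' - 1) / 2) * s ^ (2 * Δ')))) := by rw [hpre]; ring
    _ = 19514880 * C ^ 4 * (Λ₀ + 1) ^ 2 * (4 * (Λ₀ + 1) ^ 2 + 1) * L ^ 8 *
        ((q : ℝ) ^ (27 * δ) * (q : ℝ) ^ (3 * δ) * ((q : ℝ) ^ ε₀) ^ 2) *
        (s * s ^ (5 / 4 * (Δ' - 1) * 2)) := by
          rw [hspow]; field_simp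
    _ ≤ 19514880 * C ^ 4 * (Λ₀ + 1) ^ 2 * (4 * (Λ₀ + 1) ^ 2 + 1) * L ^ 8 *
        ((q : ℝ) ^ (27 * δ) * (q : ℝ) ^ (3 * δ) * ((q : ℝ) ^ ε₀) ^ 2) *
        ((L ^ 2 * mainScaleReal Δ' q) * (q : ℝ) ^ (5 / 4 * (Δ' - 1))) := by gcongr
    _ = 19514880 * C ^ 4 * (Λ₀ + 1) ^ 2 * (4 * (Λ₀ + 1) ^ 2 + 1) * L ^ 10 *
        ((q : ℝ) ^ (27 * δ) * (q : ℝ) ^ (3 * δ) * ((q : ℝ) ^ ε₀) ^ 2 * (q : ℝ) ^ (5 / 4 * (Δ' - 1))) *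
        mainScaleReal Δ' q := by ring
    _ = 19514880 * C ^ 4 * (Λ₀ + 1) ^ 2 * (4 * (Λ₀ + 1) ^ 2 + 1) * L ^ 10 *
        (q : ℝ) ^ (30 * δ + 2 * ε₀ + 5 / 4 * (Δ' - 1)) * mainScaleReal Δ' q := by rw [hqpow]

/-! ### §3. The trivial ledger in the currency of the heart -/

/-- **The trivial ledger of the finite dual core at the clean scales, in the currency of the heart.**
For `Λ₀ ≥ 0`, `0 ≤ ε₀ ≤ 1` and `ε > 0` there is `q₀` such that for every prime `q ≥ q₀`, every
`Δ′ ∈ (1, 2]` and every truncation `A` of the dual frequencies that is coordinatewise admissible —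
`A_j(r,l,m,d₁,d₂,i) ≤ Λ₀·q(r+1)(1+Z)q^{ε₀}/2^{i_j} + 1`, `Z = 4π√((l/d₁)(m/d₂)2^{i₁+i₂})/(q(r+1))` — the
doubly truncated dual core of the mollified off-diagonal, every term in absolute value and with the
prefactor `‖2q̂(2π/q)‖ = 4πq̂/q`, is at most `q^{(5/4)(Δ′−1) + 2ε₀ + ε}·mainScaleReal Δ′ q`:
`(4πq̂/q)·Σ_{r<q⁷}Σ_{l,m≤q̂^{Δ′}}|c_lc_m|Σ_{d₁∣l,d₂∣m}Σ_{i∈nearBoxes(log⁴q)}Σ_{|h_j|≤A_j}‖Φ̂_i(h/(q(r+1)))‖·N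
  ≤ q^{(5/4)(Δ′−1)+2ε₀+ε}·ms`.
The trivial exponent `κ₀ = 5/4` is what the heart has to save by cancellation.
[cite: KowalskiMichelVanderKam2000, (21)–(23) p. 12, Lemma 3.3 p. 9, §6 p. 19; HardyWright2008, Thm. 315 — derivation] -/
theorem dualLedgerTotal_scales_le {Λ₀ ε₀ ε : ℝ} (hΛ₀ : 0 ≤ Λ₀) (hε₀ : 0 ≤ ε₀) (hε₁ : ε₀ ≤ 1)
    (hε : 0 < ε) :
    ∃ q₀ : ℕ, ∀ (q : ℕ) [NeZero q], q₀ ≤ q → q.Prime → ∀ Δ' : ℝ, 1 < Δ' → Δ' ≤ 2 →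
      ∀ A : ℕ → ℕ → ℕ → ℕ → ℕ → ℕ × ℕ → ℕ × ℕ,
        (∀ r l m d₁ d₂ : ℕ, ∀ i : ℕ × ℕ,
          ((A r l m d₁ d₂ i).1 : ℝ) ≤ Λ₀ * ((q : ℝ) * ((r + 1 : ℕ) : ℝ) *
              (1 + 4 * π * Real.sqrt (((l / d₁ : ℕ) : ℝ) * ((m / d₂ : ℕ) : ℝ) * ((2 : ℝ) ^ i.1 * 2 ^ i.2)) /
                ((q : ℝ) * ((r + 1 : ℕ) : ℝ))) * (q : ℝ) ^ ε₀) / (2 : ℝ) ^ i.1 + 1 ∧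
          ((A r l m d₁ d₂ i).2 : ℝ) ≤ Λ₀ * ((q : ℝ) * ((r + 1 : ℕ) : ℝ) *
              (1 + 4 * π * Real.sqrt (((l / d₁ : ℕ) : ℝ) * ((m / d₂ : ℕ) : ℝ) * ((2 : ℝ) ^ i.1 * 2 ^ i.2)) /
                ((q : ℝ) * ((r + 1 : ℕ) : ℝ))) * (q : ℝ) ^ ε₀) / (2 : ℝ) ^ i.2 + 1) →
        4 * π * qhat q / q *
          ∑ r ∈ Finset.range (q ^ 7), ∑ l ∈ Finset.Icc 1 ⌊qhat q ^ Δ'⌋₊, ∑ m ∈ Finset.Icc 1 ⌊qhat q ^ Δ'⌋₊,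
            |mollifierCoeff (X ^ 2) (qhat q ^ Δ') l * mollifierCoeff (X ^ 2) (qhat q ^ Δ') m| *
              ∑ d₁ ∈ l.divisors, ∑ d₂ ∈ m.divisors,
                ∑ i ∈ PeterssonSplit.nearBoxes q d₁ d₂ (Real.log q ^ 4),
                  ∑ h ∈ (Finset.Icc (-((A r l m d₁ d₂ i).1 : ℤ)) (A r l m d₁ d₂ i).1) ×ˢ
                      (Finset.Icc (-((A r l m d₁ d₂ i).2 : ℤ)) (A r l m d₁ d₂ i).2),
                    ‖fourier2 (boxWeight q d₁ d₂ (l / d₁) (m / d₂) (r + 1) i) (h.1 / (q * (r + 1) : ℕ))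
                        (h.2 / (q * (r + 1) : ℕ))‖ *
                      (dualCount (q * (r + 1)) ((l / d₁ : ℕ) : ZMod (q * (r + 1)))
                        ((m / d₂ : ℕ) : ZMod (q * (r + 1))) (h.1 : ZMod (q * (r + 1)))
                        (h.2 : ZMod (q * (r + 1))) : ℝ) ≤
          (q : ℝ) ^ (5 / 4 * (Δ' - 1) + 2 * ε₀ + ε) * mainScaleReal Δ' q := by
  classical
  -- the divisor exponent and constant, the absorbed logarithms
  set δ : ℝ := min 1 (ε / 60) with hδ
  have hδ0 : 0 < δ := lt_min one_pos (by positivity)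
  have hδ1 : δ ≤ 1 := min_le_left _ _
  have h30 : 30 * δ ≤ ε / 2 := by
    have := min_le_right 1 (ε / 60); rw [← hδ] at this; linarith
  obtain ⟨C, hC1, hC⟩ := Literature.NumberTheory.Sieve.exists_card_divisors_le_mul_rpow' hδ0
  have hC0 : 0 ≤ C := le_trans zero_le_one hC1
  set K : ℝ := 19514880 * C ^ 4 * (Λ₀ + 1) ^ 2 * (4 * (Λ₀ + 1) ^ 2 + 1) with hK
  have hK0 : 0 ≤ K := by positivity
  obtain ⟨q₁, hq₁⟩ := exists_mul_log_pow_le_rpow hK0 (half_pos hε) 10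
  refine ⟨max 40 q₁, ?_⟩
  intro q _ hq hprime Δ' h1 h2 A hA
  have hq40 : 40 ≤ q := le_of_max_le_left hq
  have hqq₁ : q₁ ≤ q := le_of_max_le_right hq
  have hs1 : 1 < qhat q := one_lt_qhat hq40
  have hs0 : 0 < qhat q := lt_trans one_pos hs1
  have hq0 : (0 : ℝ) < q := by exact_mod_cast (show 0 < q by omega)
  have hq1 : (1 : ℝ) ≤ q := by exact_mod_cast (show 1 ≤ q by omega)
  have hL1 : 1 ≤ Real.log q := one_le_log hq40
  have hL0 : 0 < Real.log q := lt_of_lt_of_le one_pos hL1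
  have hL41 : 1 ≤ Real.log q ^ 4 := one_le_pow₀ hL1
  have hQ1 : (1 : ℝ) ≤ (q : ℝ) ^ ε₀ := Real.one_le_rpow hq1 hε₀
  have h4s : 4 * qhat q ^ 2 ≤ (q : ℝ) := by
    rw [← two_pi_mul_qhat_sq q, show (2 * π * qhat q) ^ 2 = π ^ 2 * (4 * qhat q ^ 2) by ring]
    have hπ : (1 : ℝ) ≤ π ^ 2 := by nlinarith [Real.pi_gt_three]
    exact le_mul_of_one_le_left (by positivity) hπ
  -- the parameters of `dualLedgerTotal_le`
  have hM1 : 1 < qhat q ^ Δ' := Real.one_lt_rpow hs1 (by linarith)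
  have hMq : qhat q ^ Δ' < q := by
    calc qhat q ^ Δ' ≤ qhat q ^ (2 : ℝ) := Real.rpow_le_rpow_of_exponent_le hs1.le h2
      _ = qhat q ^ 2 := by rw [show (2 : ℝ) = (2 : ℕ) by norm_num, Real.rpow_natCast]
      _ < q := by nlinarith
  have hy₀ : 0 < Real.log q ^ 4 := by positivity
  have hΛ : 0 ≤ (Λ₀ + 1) ^ 2 * Real.log q ^ 4 := by positivity
  have hC' : ∀ n : ℕ, ((n.divisors.card : ℕ) : ℝ) ≤ C * (n : ℝ) ^ δ := fun n ↦ hC n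
  -- the truncation, switched off outside the summed boxes
  let A' : ℕ → ℕ → ℕ → ℕ → ℕ → ℕ × ℕ → ℕ × ℕ := fun r l m d₁ d₂ i ↦
    if 1 ≤ d₁ * d₂ ∧ i ∈ PeterssonSplit.nearBoxes q d₁ d₂ (Real.log q ^ 4) then A r l m d₁ d₂ i else (0, 0)
  have hA' : ∀ r l m d₁ d₂ : ℕ, ∀ i : ℕ × ℕ,
      (((A' r l m d₁ d₂ i).1 : ℝ)) * (A' r l m d₁ d₂ i).2 ≤ (Λ₀ + 1) ^ 2 * Real.log q ^ 4 *
        (((q : ℝ) * ((r + 1 : ℕ) : ℝ)) ^ 2 *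
          (1 + 4 * π * Real.sqrt (((l / d₁ : ℕ) : ℝ) * ((m / d₂ : ℕ) : ℝ) * ((2 : ℝ) ^ i.1 * 2 ^ i.2)) /
            ((q : ℝ) * ((r + 1 : ℕ) : ℝ))) ^ 2 * ((q : ℝ) ^ ε₀) ^ 2 / ((2 : ℝ) ^ i.1 * 2 ^ i.2)) := by
    intro r l m d₁ d₂ i
    by_cases hc : 1 ≤ d₁ * d₂ ∧ i ∈ PeterssonSplit.nearBoxes q d₁ d₂ (Real.log q ^ 4)
    · simp only [A', if_pos hc]
      obtain ⟨hd, hi⟩ := hc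
      set Z : ℝ := 4 * π * Real.sqrt (((l / d₁ : ℕ) : ℝ) * ((m / d₂ : ℕ) : ℝ) * ((2 : ℝ) ^ i.1 * 2 ^ i.2)) /
        ((q : ℝ) * ((r + 1 : ℕ) : ℝ)) with hZ
      have hZ0 : 0 ≤ Z := by positivity
      have hr1 : (1 : ℝ) ≤ ((r + 1 : ℕ) : ℝ) := by exact_mod_cast Nat.succ_pos r
      -- `q ≤ X`
      have hqX : (q : ℝ) ≤ (q : ℝ) * ((r + 1 : ℕ) : ℝ) * (1 + Z) * (q : ℝ) ^ ε₀ := by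
        rw [show (q : ℝ) * ((r + 1 : ℕ) : ℝ) * (1 + Z) * (q : ℝ) ^ ε₀ =
          (q : ℝ) * ((((r + 1 : ℕ) : ℝ) * (1 + Z)) * (q : ℝ) ^ ε₀) by ring]
        exact le_mul_of_one_le_right hq0.le
          (one_le_mul_of_one_le_of_one_le (one_le_mul_of_one_le_of_one_le hr1 (by linarith)) hQ1)
      -- near box: `2^{i₁}2^{i₂} ≤ q log⁴q`
      have hKK : (2 : ℝ) ^ i.1 * 2 ^ i.2 ≤ (q : ℝ) * Real.log q ^ 4 := by
        have hfar := PeterssonSplit.not_far_of_mem_nearBoxes hi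
        rw [not_le] at hfar
        have hd' : (1 : ℝ) ≤ (d₁ : ℝ) * d₂ := by exact_mod_cast hd
        calc (2 : ℝ) ^ i.1 * 2 ^ i.2 = 2 ^ (i.1 + i.2) := (pow_add _ _ _).symm
          _ ≤ 2 ^ (i.1 + i.2) * ((d₁ : ℝ) * d₂) := le_mul_of_one_le_right (by positivity) hd'
          _ ≤ 4 * qhat q ^ 2 * Real.log q ^ 4 := hfar.le
          _ ≤ (q : ℝ) * Real.log q ^ 4 := mul_le_mul_of_nonneg_right h4s (by positivity)
      have hmain := mul_le_of_coordinatewise (Nat.cast_nonneg _) hΛ₀ (one_le_pow₀ (by norm_num))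
        (one_le_pow₀ (by norm_num)) hL41 hq1 hqX hKK (hA r l m d₁ d₂ i).1 (hA r l m d₁ d₂ i).2
      refine hmain.trans (le_of_eq ?_)
      rw [hZ]
      ring
    · simp only [A', if_neg hc, Nat.cast_zero, zero_mul]
      positivity
  have key := dualLedgerTotal_le hprime hM1 hMq (q ^ 7) hy₀ hΛ hδ0.le hC' A' hA'
  -- the chain, for the switched-off truncation
  have hrhs := ledger_rhs_scales_le hq40 h1 h2 hC0 hδ0.le hδ1 hΛ₀ hε₀ hε₁
  have hKL : K * Real.log q ^ 10 ≤ (q : ℝ) ^ (ε / 2) := hq₁ q hqq₁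
  have hms0 : 0 ≤ mainScaleReal Δ' q := mainScaleReal_nonneg _ _
  have hexp : (q : ℝ) ^ (30 * δ + 2 * ε₀ + 5 / 4 * (Δ' - 1)) ≤
      (q : ℝ) ^ (ε / 2 + 2 * ε₀ + 5 / 4 * (Δ' - 1)) :=
    Real.rpow_le_rpow_of_exponent_le hq1 (by linarith)
  have hpre0 : 0 ≤ 4 * π * qhat q / q := by positivity
  have hfin : K * Real.log q ^ 10 * (q : ℝ) ^ (30 * δ + 2 * ε₀ + 5 / 4 * (Δ' - 1)) * mainScaleReal Δ' q ≤
      (q : ℝ) ^ (5 / 4 * (Δ' - 1) + 2 * ε₀ + ε) * mainScaleReal Δ' q := by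
    calc K * Real.log q ^ 10 * (q : ℝ) ^ (30 * δ + 2 * ε₀ + 5 / 4 * (Δ' - 1)) * mainScaleReal Δ' q
        ≤ (q : ℝ) ^ (ε / 2) * (q : ℝ) ^ (ε / 2 + 2 * ε₀ + 5 / 4 * (Δ' - 1)) * mainScaleReal Δ' q :=
          mul_le_mul_of_nonneg_right (mul_le_mul hKL hexp (by positivity) (by positivity)) hms0
      _ = (q : ℝ) ^ (5 / 4 * (Δ' - 1) + 2 * ε₀ + ε) * mainScaleReal Δ' q := by
          rw [← Real.rpow_add hq0]; ring_nf
  have key' := le_trans (mul_le_mul_of_nonneg_left key hpre0) (hrhs.trans hfin)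
  -- the two truncations agree on the summed boxes
  refine Eq.trans_le (congrArg₂ (· * ·) rfl ?_) key'
  refine Finset.sum_congr rfl fun r _ ↦ Finset.sum_congr rfl fun l _ ↦ Finset.sum_congr rfl fun m _ ↦ ?_
  refine congrArg₂ (· * ·) rfl ?_
  refine Finset.sum_congr rfl fun d₁ hd₁ ↦ Finset.sum_congr rfl fun d₂ hd₂ ↦
    Finset.sum_congr rfl fun i hi ↦ ?_
  have hd : 1 ≤ d₁ * d₂ := Nat.mul_pos (Nat.pos_of_mem_divisors hd₁) (Nat.pos_of_mem_divisors hd₂)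
  have hAeq : A' r l m d₁ d₂ i = A r l m d₁ d₂ i := by simp only [A', if_pos (And.intro hd hi)]
  rw [hAeq]

/-! ### §4. The heights of L2's truncation are coordinatewise admissible (`Λ₀ = 2/π`) -/

/-- `√(αβ·2K₂)·√(2K₁) = 2√(αβ·K₁K₂)`. [folklore] -/
theorem sqrt_two_mul_sqrt_two_mul {α β K₂ : ℝ} (K₁ : ℝ) (hα : 0 ≤ α) (hβ : 0 ≤ β) (hK₂ : 0 ≤ K₂) :
    Real.sqrt (α * β * (2 * K₂)) * Real.sqrt (2 * K₁) = 2 * Real.sqrt (α * β * (K₁ * K₂)) := by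
  rw [← Real.sqrt_mul (by positivity), show α * β * (2 * K₂) * (2 * K₁) = 2 ^ 2 * (α * β * (K₁ * K₂)) by ring,
    Real.sqrt_mul (by positivity), Real.sqrt_sq (by norm_num)]

/-- **L2's first height is admissible with `Λ₀ = 2/π`**: in the syntactic shape of
`OffDiagDualTruncationBox.tsum_tail_norm_fourier2_boxWeight_le` (`D₁ = (1+Z′)/(K₁/2)`, `Z′ = 2Z`),
`c·D₁/(2π)·Q ≤ (2/π)·c(1+Z)Q/K₁`. [cite: KowalskiMichelVanderKam2000, Lemma 3.3 p. 9 — derivation] -/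
theorem truncHeight_fst_le {α β K₁ K₂ c den Q : ℝ} (hα : 0 ≤ α) (hβ : 0 ≤ β) (hK₁ : 0 < K₁) (hK₂ : 0 ≤ K₂)
    (hc : 0 ≤ c) (hden : 0 ≤ den) (hQ : 0 ≤ Q) :
    c * ((1 + 4 * π * Real.sqrt (α * β * (2 * K₂)) / den * Real.sqrt (2 * K₁)) / (K₁ / 2)) / (2 * π) * Q ≤
      2 / π * (c * (1 + 4 * π * Real.sqrt (α * β * (K₁ * K₂)) / den) * Q) / K₁ := by
  have hZ : 4 * π * Real.sqrt (α * β * (2 * K₂)) / den * Real.sqrt (2 * K₁) =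
      2 * (4 * π * Real.sqrt (α * β * (K₁ * K₂)) / den) := by
    rw [div_mul_eq_mul_div, mul_assoc (4 * π), sqrt_two_mul_sqrt_two_mul K₁ hα hβ hK₂]; ring
  rw [hZ]
  set Z : ℝ := 4 * π * Real.sqrt (α * β * (K₁ * K₂)) / den with hZdef
  have hZ0 : 0 ≤ Z := by positivity
  rw [show c * ((1 + 2 * Z) / (K₁ / 2)) / (2 * π) * Q = (1 + 2 * Z) * (c * Q / (π * K₁)) by
      field_simp,
    show 2 / π * (c * (1 + Z) * Q) / K₁ = (2 + 2 * Z) * (c * Q / (π * K₁)) by field_simp]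
  exact mul_le_mul_of_nonneg_right (by linarith) (by positivity)

/-- **L2's second height is admissible with `Λ₀ = 2/π`** (the swapped box, `boxWeight_swap`):
`c·D₂/(2π)·Q ≤ (2/π)·c(1+Z)Q/K₂`. [cite: KowalskiMichelVanderKam2000, Lemma 3.3 p. 9 — derivation] -/
theorem truncHeight_snd_le {α β K₁ K₂ c den Q : ℝ} (hα : 0 ≤ α) (hβ : 0 ≤ β) (hK₁ : 0 ≤ K₁) (hK₂ : 0 < K₂)
    (hc : 0 ≤ c) (hden : 0 ≤ den) (hQ : 0 ≤ Q) :
    c * ((1 + 4 * π * Real.sqrt (β * α * (2 * K₁)) / den * Real.sqrt (2 * K₂)) / (K₂ / 2)) / (2 * π) * Q ≤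
      2 / π * (c * (1 + 4 * π * Real.sqrt (α * β * (K₁ * K₂)) / den) * Q) / K₂ := by
  have h := truncHeight_fst_le (K₁ := K₂) (K₂ := K₁) hβ hα hK₂ hK₁ hc hden hQ (c := c) (den := den) (Q := Q)
  rwa [show β * α * (K₂ * K₁) = α * β * (K₁ * K₂) by ring] at h

/-- Ceilings cost one: `x ≤ B`, `x ≥ 0` ⇒ `⌈x⌉ ≤ B + 1`. [folklore] -/
theorem natCeil_le_add_one {x B : ℝ} (hx : 0 ≤ x) (h : x ≤ B) : ((⌈x⌉₊ : ℕ) : ℝ) ≤ B + 1 :=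
  (Nat.ceil_lt_add_one hx).le.trans (by linarith)

end Summit.Parity.GeneralizedHardyLittlewood.Theorems.BeyondDiagonalBeatsQuarter.OffDiag
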